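import Summits.AnomalousDissipation.AnomalousDissipation.Theorems.SolenoidalFractalHomogenisationLagrangianCarrierConstructionBookkeepingCore
import Literature.Analysis.FluidPDE.LagrangianLatticeCarrier
import HarnessLib

/-!
# K3L `LagrangianCarrierConstruction` (stmt-AnomalousDissipation-24913), line `birth`: the registered stub
# `stub_bookkeepingL` BY NAME (`--supports stmt-AnomalousDissipation-24913`)

Summits-side file (everything proved; no definitions, no named facts). `stub_bookkeepingL` has, literally, the name and
signature of the registered stub of the planner's skeleton `Cruxes.LagrangianCarrierConstruction.Birth`
(r21 `LagrangianCarrierConstruction_birth_v2_tree.lean`, sha16 ad9036e1528bcc84; composition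
`LagrangianCarrierConstruction_of := _of_hyps stub_bookkeepingL stub_flowsL stub_regularL`): for every word design `W`,
constants `c, ν₀, K, θ₀ > 0` and minimal separation `Λ₀` there is a Lagrangian lattice carrier datum
(`LagrangianLatticeCarrier k`) replaying `W` with `gain = c`, `nu0 = ν₀`, `K = K`, whose Eulerian bookkeeping is `Permissible`,
whose refresh windows are whole fine periods (W1) and nested (W2), whose strain is within budget (S: `strain m ≤ θ (m+1)`),
inside the super-geometric template (T1)–(T5), with the amplitude law `a_{m+1} ≤ N_{m+1}^{1 − α₀}` (DEC, `α₀ = 1/16`).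

Construction: the Eulerian datum `D`, the integer `M` and the integer ratio roots `b_m` (`N_{m+1}/N_m = b_m^16`) of
`…BookkeepingCore.bookkeeping_core` (the explicit doubly-exponential family `N_m = B^(16(2^m−1))`, `b_m = B^(2^m)`), with
strain budgets `θ_0 = θ₀`, `θ_{m+1} = θ₀/b_m` ((T4) with equality), refresh windows `refresh_{m+1} = b_m · physPeriod_{m+1}`
((W1), (T5) with equality; `refresh_0 = refresh_1`), nested because `physPeriod_m = M b_m⁸ physPeriod_{m+1}` gives
`refresh_{j+1} = (b_j M b_{j+1}⁷) · refresh_{j+2}`; the strain clause is the core's inequality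
`(a_1 + ⋯ + a_m) b_m physPeriod_{m+1} ≤ θ₀/b_m`. The level fields `b` and the displacements `disp` are set to `0` (junk):
their Lagrangian insertion (`IsLagrangian`) is the separate registered stub `stub_flowsL`, regularity is `stub_regularL`.
This is the construction side of route-1's rung leaf F-D1.A0 (a frontier FORMAL rung); it is NOT a proof of anomalous
dissipation, of Onsager's conjecture, or of the crux `LagrangianCarrierConstruction` by itself.
-/

set_option linter.dupNamespace false

noncomputable section

namespace Summit.AnomalousDissipation.AnomalousDissipation.Theorems.SolenoidalFractalHomogenisation.LagrangianCarrierConstruction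

open Literature.Analysis.FluidPDE Literature.Analysis.FluidPDE.LatticeShear
open Summit.AnomalousDissipation.AnomalousDissipation.Theorems.SolenoidalFractalHomogenisation.PermissibleCarrier
  (physPeriod_pos)

/-- **`stub_bookkeepingL` of the K3L birth line** (registered name and signature, verbatim): for every word design `W`,
constants `c, ν₀, K, θ₀ > 0` and minimal separation `Λ₀` there is a Lagrangian lattice carrier datum replaying `W` with
`gain = c`, `nu0 = ν₀`, `K = K` whose bookkeeping is `Permissible`, with (W1) windows = whole fine periods, (W2) nested windows,
(S) strain within budget, (T1) prescribed and super-geometric separation, (T2)–(T5), and (DEC) with `α₀ = 1/16`.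
Witness: `bookkeeping_core` + `θ_{m+1} = θ₀/b_m`, `refresh_{m+1} = b_m · physPeriod_{m+1}`, `b = disp = 0`.
[cite: ArmstrongVicol2025, §2.2 (PDF p. 12: the two constraints on the refresh windows τ″_m) and §3 (3.42)–(3.43)] -/
theorem stub_bookkeepingL : ∀ k (W : Literature.Analysis.FluidPDE.LatticeShear.LatticeWord k) (c ν₀ K θ₀ : ℝ) (Λ₀ : ℕ), 0 < c → 0 < ν₀ → 0 < K → 0 < θ₀ → ∃ E : Literature.Analysis.FluidPDE.LatticeShear.LagrangianLatticeCarrier k, E.design = W ∧ E.gain = c ∧ E.nu0 = ν₀ ∧ E.K = K ∧ E.toFractalCarrierData.Permissible ∧ (∀ m, ∃ r : ℕ, 0 < r ∧ E.refresh (m + 1) = (r : ℝ) * E.toFractalCarrierData.physPeriod (m + 1)) ∧ (∀ m, ∃ q : ℕ, 0 < q ∧ E.refresh m = (q : ℝ) * E.refresh (m + 1)) ∧ (∀ m, E.strain m ≤ E.θ (m + 1)) ∧ (∀ m, Λ₀ * E.N m ≤ E.N (m + 1)) ∧ (∀ m, E.N m ^ 2 ≤ E.N (m + 1)) ∧ (∀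 m, E.cellVisc (m + 1) * ((E.N (m + 1) : ℝ) / E.N m) ^ (1 / 4 : ℝ) ≤ 1) ∧ (∀ m, E.K * ((E.N (m + 1) : ℝ) / E.N m) ^ (1 / 4 : ℝ) ≤ ((E.N (m + 1) : ℝ) / E.N m) * E.cellVisc (m + 1)) ∧ (∀ m, E.θ (m + 1) * ((E.N (m + 1) : ℝ) / E.N m) ^ (1 / 16 : ℝ) ≤ θ₀) ∧ (∀ m, ((E.N (m + 1) : ℝ) / E.N m) ^ (1 / 16 : ℝ) * E.physPeriod (m + 1) ≤ E.refresh (m + 1)) ∧ (∃ α₀ : ℝ, 0 < α₀ ∧ ∀ m, E.a (m + 1) ≤ ((E.N (m + 1) : ℝ)) ^ (1 - α₀)) := by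
  intro k W c ν₀ K θ₀ Λ₀ hc hν₀ hK hθ₀
  obtain ⟨D, hD, hg, hn, hKK, hPerm, hT1a, hT1b, hdec, M, b, hM, hb, hratio, hT2, hT3, hper, hstrain⟩ :=
    bookkeeping_core k W c ν₀ K θ₀ Λ₀ hc hν₀ hK hθ₀
  have hb0 : ∀ m, (0 : ℝ) < b m := fun m => by exact_mod_cast hb m
  have hM0 : (0 : ℝ) < M := by exact_mod_cast hM
  have hpp : ∀ m, 0 < D.physPeriod m := physPeriod_pos D
  -- strain budgets `θ 0 = θ₀`, `θ (m+1) = θ₀ / b m`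
  obtain ⟨θf, hθ0, hθS⟩ : ∃ θf : ℕ → ℝ, θf 0 = θ₀ ∧ ∀ m, θf (m + 1) = θ₀ / b m :=
    ⟨fun m => match m with | 0 => θ₀ | j + 1 => θ₀ / b j, rfl, fun _ => rfl⟩
  have hθpos : ∀ m, 0 < θf m := fun m => by
    cases m with
    | zero => rw [hθ0]; exact hθ₀
    | succ j => rw [hθS]; exact div_pos hθ₀ (hb0 j)
  -- refresh windows `refresh 0 = refresh 1`, `refresh (m+1) = b m · physPeriod (m+1)`
  obtain ⟨rf, hr0, hrS⟩ : ∃ rf : ℕ → ℝ, rf 0 = (b 0 : ℝ) * D.physPeriod 1 ∧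
      ∀ m, rf (m + 1) = (b m : ℝ) * D.physPeriod (m + 1) :=
    ⟨fun m => match m with | 0 => (b 0 : ℝ) * D.physPeriod 1 | j + 1 => (b j : ℝ) * D.physPeriod (j + 1),
      rfl, fun _ => rfl⟩
  have hrpos : ∀ m, 0 < rf m := fun m => by
    cases m with
    | zero => rw [hr0]; exact mul_pos (hb0 0) (hpp 1)
    | succ j => rw [hrS]; exact mul_pos (hb0 j) (hpp _)
  -- THE WITNESS (level fields and displacements are junk `0` here: their insertion is `stub_flowsL`)
  refine ⟨⟨D, rf, θf, fun _ _ _ => 0, fun _ _ _ _ => 0, hrpos, hθpos⟩, hD, hg, hn, hKK, hPerm,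
    ?_, ?_, ?_, hT1a, hT1b, ?_, ?_, ?_, ?_, 1 / 16, by norm_num, hdec⟩
  · -- (W1) every refresh window of level `m+1` is `b m` whole physical periods
    intro m
    exact ⟨b m, hb m, hrS m⟩
  · -- (W2) nested windows
    intro m
    cases m with
    | zero =>
      refine ⟨1, one_pos, ?_⟩
      show rf 0 = ((1 : ℕ) : ℝ) * rf (0 + 1)
      rw [hr0, hrS, Nat.cast_one, one_mul]
    | succ j =>
      refine ⟨b j * M * b (j + 1) ^ 7, Nat.mul_pos (Nat.mul_pos (hb j) hM) (pow_pos (hb _) _), ?_⟩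
      show rf (j + 1) = ((b j * M * b (j + 1) ^ 7 : ℕ) : ℝ) * rf (j + 1 + 1)
      rw [hrS j, hrS (j + 1), hper (j + 1)]
      push_cast
      ring
  · -- (S) strain within budget: `(a_1 + ⋯ + a_m) · (b m · physPeriod (m+1)) ≤ θ₀ / b m`
    intro m
    show (∑ i ∈ Finset.range m, D.a (i + 1)) * rf (m + 1) ≤ θf (m + 1)
    rw [hrS, hθS]
    exact hstrain m
  · -- (T2)
    intro m
    show D.cellVisc (m + 1) * (((D.N (m + 1) : ℕ) : ℝ) / ((D.N m : ℕ) : ℝ)) ^ (1 / 4 : ℝ) ≤ 1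
    rw [hratio, rpow_pow_sixteen_quarter (hb0 m).le]
    exact hT2 m
  · -- (T3)
    intro m
    show D.K * (((D.N (m + 1) : ℕ) : ℝ) / ((D.N m : ℕ) : ℝ)) ^ (1 / 4 : ℝ) ≤
      (((D.N (m + 1) : ℕ) : ℝ) / ((D.N m : ℕ) : ℝ)) * D.cellVisc (m + 1)
    rw [hKK, hratio, rpow_pow_sixteen_quarter (hb0 m).le]
    exact hT3 m
  · -- (T4) `θ (m+1) · b m = θ₀`
    intro m
    show θf (m + 1) * (((D.N (m + 1) : ℕ) : ℝ) / ((D.N m : ℕ) : ℝ)) ^ (1 / 16 : ℝ) ≤ θ₀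
    rw [hθS, hratio, rpow_pow_sixteen_inv (hb0 m).le, div_mul_cancel₀ _ (hb0 m).ne']
  · -- (T5) `b m · physPeriod (m+1) = refresh (m+1)`
    intro m
    show (((D.N (m + 1) : ℕ) : ℝ) / ((D.N m : ℕ) : ℝ)) ^ (1 / 16 : ℝ) * D.physPeriod (m + 1) ≤ rf (m + 1)
    rw [hratio, rpow_pow_sixteen_inv (hb0 m).le, hrS]

end Summit.AnomalousDissipation.AnomalousDissipation.Theorems.SolenoidalFractalHomogenisation.LagrangianCarrierConstruction

end
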